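/-
Copyright (c) 2026. All rights reserved.
Released under Apache 2.0 license as described in the file LICENSE.
Authors: abc-iut cell — seat abc-iut-w5-d225 (wave 5; §4(iii) non-vacuity programme, L4 row
`EllipticCuspidalization` of abc-iut-w5-d243's INTERFACE-NV-CENSUS; L4-lead QUICK RULINGS #3z (2)).
-/
import Literature.AnabelianGeometry.AbsoluteAnabelian.AbsTopII.EllipticCuspidalization
import Mathlib.Topology.Instances.ZMod
import HarnessLib

/-!
# Joint satisfiability of the [AbsTopII] Cor 3.3 output record `EllipticCuspidalization` (DEGENERATE witness)

S. Mochizuki, *Topics in absolute anabelian geometry II*, Cor 3.3 pp. 67–69 ("Pro-`Σ` Elliptic Cuspidalization I: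
Algorithms").  abc-iut-L4-t1 typed its OUTPUT as the structure `AbsTopII.EllipticCuspidalization E` over an
abstract extension `E = (1 → Δ' → Π' → G' → 1)`: 28 fields, 14 of them axioms (index-`2` open `Π_D ⊆ Π_C` with
torsion-free `Π_D ∩ Δ_C`, normal open `Π_V`, the fibre-product glueing, uniqueness of outer liftings, centre-freeness
of `Π_{U_V}`, …).  abc-iut-w5-d243's INTERFACE-NV-CENSUS (03:03Z) lists it with ZERO kernel inhabitants (8 consumer
files): the 14 axioms were never shown JOINTLY SATISFIABLE in the kernel.

This PROOF-ONLY file (no `def`/`instance`/`structure`; the witness is built inside the theorem term) gives a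
DEGENERATE witness — HONEST LABEL: a finite toy, NOT an elliptic cuspidalization of a curve:
`Π' = G' = 1` (the trivial profinite group `ℤ/1`), `k'`-core `Π_C = ℤ/2 ↠ G' = 1` (so `Δ_C = ℤ/2`), `Π_D = 1`
(open, index `2`, `Π_D ∩ Δ_C = 1` torsion-free), `Π_V = Π' = 1`, `Π_U = Π_{U_X} = 1` with the obvious maps,
`N = 1`, `Σ = ∅`, no cusps; the glueing, outer-lifting-uniqueness and centre clauses hold because every group in
sight on the `Π'`-side is trivial.  WHAT THIS CERTIFIES: the axiom package of the record is consistent (no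
theorem over `EllipticCuspidalization E` is vacuously true for want of ANY instance); WHAT IT DOES NOT: that the
package is satisfiable at a genuine `Π_X` of a once-punctured elliptic curve (needs étale `π₁`, not in Mathlib) —
§4(iii) label «degenerate».  Nothing here bears on the disputed [IUTchIII] Cor. 3.12; typed ≠ proved.
-/

namespace Literature.AnabelianGeometry.AbsoluteAnabelian.AbsTopII

open CategoryTheory Topology

/-- **`EllipticCuspidalization` is jointly satisfiable (DEGENERATE finite toy)**: over the trivial extension
`Π' = G' = ℤ/1` there is an `EllipticCuspidalization` with `k'`-core `ℤ/2 ↠ 1`, `Π_D = 1` (index 2),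
`Π_V = Π_U = Π_{U_X} = 1`, `N = 1`, `Σ = ∅`, no cusps.  Honest label: degenerate — not a cuspidalization of a curve.
[cite: MochizukiAbsTopII2013, Cor 3.3 pp.67-69] -/
theorem EllipticCuspidalization.exists_nonempty_degenerate :
    ∃ E : FundamentalExtension.{0}, Subsingleton E.arith ∧ Nonempty (EllipticCuspidalization E) := by
  -- the trivial profinite group `T = ℤ/1` and the two-element group `M = ℤ/2` (discrete, finite)
  let T : Type := Multiplicative (ZMod 1)
  let M : Type := Multiplicative (ZMod 2)
  haveI hT : Subsingleton T := inferInstanceAs (Subsingleton (Multiplicative (Fin 1)))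
  -- `E₁ : 1 → 1 → T → T → 1` (Π' = G' = 1)
  let E₁ : FundamentalExtension.{0} :=
    { arith := ProfiniteGrp.of T, gal := ProfiniteGrp.of T, aug := ContinuousMonoidHom.id T,
      aug_surjective := Function.surjective_id }
  -- the core `Π_C = ℤ/2 ↠ G' = 1`
  let C₀ : FundamentalExtension.{0} :=
    { arith := ProfiniteGrp.of M, gal := ProfiniteGrp.of T, aug := 1,
      aug_surjective := fun t => ⟨1, Subsingleton.elim _ _⟩ }
  -- `Π' → Π_C`: the trivial homomorphism (an open injection since `Π'` is trivial and `Π_C` discrete)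
  let f : E₁ ⟶ C₀ :=
    { arith := 1, gal := ContinuousMonoidHom.id T, comm := fun _ => Subsingleton.elim _ _ }
  haveI hE : Subsingleton E₁.arith := hT
  have hf_range : f.arith.toMonoidHom.range = (⊥ : Subgroup C₀.arith) := by
    refine le_antisymm ?_ bot_le
    rintro y ⟨x, rfl⟩
    exact Subgroup.mem_bot.2 rfl
  refine ⟨E₁, hE, ⟨{
    N := 1
    Sigma := ∅
    N_isSigmaInteger := ⟨Nat.one_pos, fun p hp h1 => absurd (Nat.dvd_one.1 h1) hp.one_lt.ne'⟩
    core := C₀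
    toCore := f
    toCore_isOpenInjective :=
      { arith_injective := Function.injective_of_subsingleton _
        isOpen_range_arith := isOpen_discrete _
        gal_injective := Function.injective_id
        isOpen_range_gal := isOpen_discrete _ }
    toCore_gal_bijective := Function.bijective_id
    PiD := ⊥
    isOpen_PiD := isOpen_discrete _
    index_PiD := by
      rw [Subgroup.index_bot]
      change Nat.card (Multiplicative (ZMod 2)) = 2
      rw [Nat.card_congr Multiplicative.toAdd, Nat.card_zmod]
    torsionFree_PiD := ⟨fun n _ a b _ =>
      Subtype.ext ((Subgroup.mem_bot.1 (Subgroup.mem_inf.1 a.2).1).trans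
        (Subgroup.mem_bot.1 (Subgroup.mem_inf.1 b.2).1).symm)⟩
    PiV := ⊤
    normal_PiV := inferInstance
    isOpen_PiV := isOpen_discrete _
    map_PiV_le := by
      rintro y ⟨x, -, rfl⟩
      exact Subgroup.mem_bot.2 rfl
    cuspU := E₁
    projU := f
    range_projU := hf_range
    projU_gal_bijective := Function.bijective_id
    cuspUX := E₁
    proj := 𝟙 E₁
    proj_arith_surjective := Function.surjective_id
    proj_gal_bijective := Function.bijective_id
    glue :=
      { toFun := fun _ => 1
        invFun := fun _ => 1
        left_inv := fun x => Subtype.ext (Subsingleton.elim _ _)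
        right_inv := fun x => Subtype.ext (Subsingleton.elim _ _)
        map_mul' := fun _ _ => (mul_one _).symm }
    glue_comm := fun _ => rfl
    lifting_unique := fun ρ ρ' _ _ _ _ => MonoidHom.ext fun g => by
      rw [Subsingleton.elim g 1, map_one, map_one]
    center_PiUV_eq_bot := eq_bot_iff.2 fun x _ => Subgroup.mem_bot.2 (Subtype.ext (Subsingleton.elim _ _))
    cusps :=
      { Cusp := PEmpty.{1}
        Dcusp := fun x => x.elim
        Icusp := fun x => x.elim
        Icusp_eq := fun x => x.elim
        isClosed_Dcusp := fun x => x.elim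
        eq_of_conj := fun x => x.elim } }⟩⟩

end Literature.AnabelianGeometry.AbsoluteAnabelian.AbsTopII
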